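import Literature.MathematicalPhysics.QuantumFieldTheory.Balaban1983to89.Node00.TorusCoverPropSixGauge10
import Literature.MathematicalPhysics.QuantumFieldTheory.Balaban1983to89.Node00.TorusCoverLocalGauge
import Literature.MathematicalPhysics.QuantumFieldTheory.Balaban1983to89.Node00.LocalGaugeCoDivergenceLetters

/-!
# NODE 00 — THE TORUS→`ℤᵈ` TWIN, FILE 4b′: [6] PROPOSITION 6 AT NODE 00's `ℤᵈ` OBJECTS ⇒ THE LOCAL GAUGE OF [15] (152) ON A GRID CUBE OF THE TORUS WITH **THREE**
# LETTERS — `‖A‖ ≤ 2r`, `‖∇^{η_n}A‖ ≤ 2r` (FILE 28b) AND PRINT'S SECOND-ORDER LETTER `‖∂^{η_n*}∂^{η_n}A‖ ≤ 2r` ON THE DEEP BONDS OF THE CUBE (33b's `Sect2.codiffCurlA`)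

Cell `pub-ymgap`, seat `pub-ymgap-dag-n07-e` generation 13 (R141 (C), DAG node N07 = [15]; cell INBOX INTENT-34 of 2026-08-27).  NEW leaf, PROOF kind (no `def`); CONSUMED BY
NAME, nothing modified: 34a `Node00.TorusCoverPropSixGauge10` (`exists_suGauge_letters10_of_gaugedBoundB8`, the closed forms at the trivial background), FILE 28b
`Node00.TorusCoverLocalGauge` (`eq_of_cover_eq_of_mem_cubeExt`, `add_e_mem_cubeExt_of_shift_mem_image`, `cfgExp_eq_expI`, `zdLift_mem_specialUnitaryUnits`), FILES 25∕26
(`zdLift`, `cover_add_e`, `cover_sub_e`, `inAk_zdLift_of_top`, `cubeIdx'`, `propCube`, `tol_of_level_pred`, `cubeExt_subset_box_propCube`), 33b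
`Node00.LocalGaugeCoDivergenceLetters` (`Sect2.curlA`, `Sect2.codiffCurlA`, `Sect2.bondsDeep`), node00-def-cube's `zdCub ∕ prop6Printed_zdCub_iff`, r15's `cover`,
def-R's `cubeEnl`, def-P11's `Sect2.regionOfSet`, r11's `gaugeU ∕ expI ∕ grad`.  `--supports stmt-QuantumFields-20541` (K0⁷).
[15] = [Balaban1985Variational]; [6] = [Balaban1985RegularSpaces]; [I] = [Balaban1987RG1]; [III] = [Balaban1988Convergent].

WHY.  FILE 28b pushed [6] Proposition 6's gauge down to one non-wrapping grid cube of the torus with the letters `|A|`, `|∇A|` of [15] (152); 34a extracts the third member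
«(Lʲη)³|∂^{η*}∂^ηA| ≤ r» of (1.136) on the box; this file carries it through the same push-down.  The only new geometry: the second-order stencil of a bond `⟨x, x+e_μ⟩`
(`x`, `x+e_μ`, `x ± e_ν`, `x + e_μ ± e_ν`) must lift into the box — exactly 33b's DEEP bonds of the cube, with backward unit steps lifting like forward ones
(`sub_e_mem_cubeExt_of_unshift_mem_image`) — and the identification of 33b's torus operator with lit-balaban's `pdiv η 1 (plaqCovDeriv η 1 ·)` under the cover
(`codiffCurlA_cover_eq_pdiv`).  Consumer: 34c's token `Gauge152OfClassTopStepR10` (the (152) step token concluding 33b's clause `Sect2.LocalGauge10On`), hence 33c's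
`coDivSmallOn_of_localGauge10On` on every grid cube of a class member.

CONTENTS.  §1 `pdiv_plaqCovDeriv_one_eq_sum`, ★ `codiffCurlA_cover_eq_pdiv`.  §2 `sub_e_mem_cubeExt_of_unshift_mem_image`, ★★★ `exists_localGauge10_cube_of_prop6`.

HONEST FRAMING: a composition by name; [6] Proposition 6 at the member is the HYPOTHESIS `hP6` (N05's node; never asserted here); nothing of Bałaban discharged; N07 ∕ N05 ∕ K0⁷
NOT discharged; counts unmoved (5∕27); one finite T⁴ programme at fixed ε — NOT continuum ∕ ℝ⁴ ∕ infinite volume ∕ OS ∕ mass gap ∕ Clay.  No `sorry`, no `def`, no `instance`,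
no `notation`.
-/

noncomputable section

namespace Literature.MathematicalPhysics.QuantumFieldTheory.Balaban1983to89.Node00

open scoped Matrix.Norms.L2Operator
open Complex (I)
open B7Prop1Explicit (e e_apply)
open B7Prop1Local (InBox AgreeOn)
open B7Prop2Explicit (unitaryUnits mem_unitaryUnits)
open B7Prop2SpecialUnitary (specialUnitaryUnits mem_specialUnitaryUnits)
open B7Eq78Linearization (conjR conjR_apply)
open B8Ineq132 (covDerivFwd covDeriv BondTouches)
open B8Eq131Cubes (box cube tcube bLo bHi)
open B8Eq138LandauZd (logCfg)
open B8Eq184Proof (cfgExp)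
open B8ScaledSupNorm (msup Bdd bondNorm)
open B8Eq146AExpansion (plaqCovDeriv plaqCovDeriv_eq_covDerivFwd)
open B8Eq143PlaqExpansion (pdiv)
open B15Eq112TorusCover (cover)
open B14DomainGeom (Pt)
open B14.Eq213MaximalDomains (side cubeExt)
open B12RegularSpaces111 (gaugeU expI grad)
open B8LeafModelZd (ZdIdx)
open B8Ineq132 (InAk)

variable {d N : ℕ} [NeZero N]

/-! ## §1  The torus letter `Sect2.codiffCurlA` at `π x` is lit-balaban's `pdiv η 1 (plaqCovDeriv η 1 ·)` at `x` under the push-down -/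

section Identity

variable {P : Params}

omit [NeZero N] in
/-- [6] (1.2) at the trivial background as ONE sum over all directions: `(∂^{η*}∂^ηA)(x, x+e_μ) = Σ_ν η⁻¹[(∂^ηA)(p_{νμ}(x−e_ν)) − (∂^ηA)(p_{νμ}(x))]`
(antisymmetry folds `−Σ_{ν>μ}(D^{η*}_ν F_{μν})` into `+Σ_{ν>μ}(D^{η*}_ν F_{νμ})`; the `ν = μ` term vanishes) — the shape of 33b's torus letter `Sect2.codiffCurlA`.
[cite: Balaban1985RegularSpaces, (1.2) p.76 (bookkeeping)] -/
theorem pdiv_plaqCovDeriv_one_eq_sum (η : ℝ) (A' : B7Prop1Explicit.Site d → Fin d → MatA N) (μ : Fin d) (x : B7Prop1Explicit.Site d) :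
    pdiv η (1 : B7Prop1Explicit.Site d → Fin d → (MatA N)ˣ) (plaqCovDeriv η 1 A') μ x =
      ∑ ν : Fin d, η⁻¹ • (plaqCovDeriv η (1 : B7Prop1Explicit.Site d → Fin d → (MatA N)ˣ) A' ν μ (x - e ν) -
        plaqCovDeriv η (1 : B7Prop1Explicit.Site d → Fin d → (MatA N)ˣ) A' ν μ x) := by
  have hdiag : η⁻¹ • (plaqCovDeriv η (1 : B7Prop1Explicit.Site d → Fin d → (MatA N)ˣ) A' μ μ (x - e μ) -
      plaqCovDeriv η (1 : B7Prop1Explicit.Site d → Fin d → (MatA N)ˣ) A' μ μ x) = 0 := by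
    rw [plaqCovDeriv_one_apply, plaqCovDeriv_one_apply, sub_self, sub_self, sub_self, smul_zero]
  have hdisj : Disjoint (Finset.Iio μ) (Finset.Ioi μ) :=
    Finset.disjoint_left.2 fun ν h1 h2 => lt_asymm (Finset.mem_Iio.1 h1) (Finset.mem_Ioi.1 h2)
  have hsplit : ∑ ν : Fin d, η⁻¹ • (plaqCovDeriv η (1 : B7Prop1Explicit.Site d → Fin d → (MatA N)ˣ) A' ν μ (x - e ν) -
        plaqCovDeriv η (1 : B7Prop1Explicit.Site d → Fin d → (MatA N)ˣ) A' ν μ x) =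
      ∑ ν ∈ Finset.Iio μ ∪ Finset.Ioi μ, η⁻¹ • (plaqCovDeriv η (1 : B7Prop1Explicit.Site d → Fin d → (MatA N)ˣ) A' ν μ (x - e ν) -
        plaqCovDeriv η (1 : B7Prop1Explicit.Site d → Fin d → (MatA N)ˣ) A' ν μ x) := by
    symm
    refine Finset.sum_subset (Finset.subset_univ _) fun ν _ hν => ?_
    simp only [Finset.mem_union, Finset.mem_Iio, Finset.mem_Ioi, not_or, not_lt] at hν
    have : ν = μ := le_antisymm hν.2 hν.1
    subst this
    exact hdiag
  rw [hsplit, Finset.sum_union hdisj, pdiv, sub_eq_add_neg, ← Finset.sum_neg_distrib]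
  congr 1
  · exact Finset.sum_congr rfl fun ν _ => by rw [covDeriv_one_apply]
  · refine Finset.sum_congr rfl fun ν _ => ?_
    rw [covDeriv_one_apply, plaqCovDeriv_one_swap η A' ν μ (x - e ν), plaqCovDeriv_one_swap η A' ν μ x, ← smul_neg]
    congr 1; abel

omit [NeZero N] in
/-- ★ **THE TORUS LETTER IS THE BOX OPERATOR UNDER THE PUSH-DOWN**: if the torus exponent `A` and the box exponent `A′` agree through the cover on the lifted cube
(`A⟨π z, κ⟩ = A′(z, κ)` for `z ∈ cubeExt S a 0`) and the whole second-order stencil of the bond `⟨x, x+e_μ⟩` lies in the lifted cube, then 33b's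
`Sect2.codiffCurlA η A (π x) μ` IS lit-balaban's `pdiv η 1 (plaqCovDeriv η 1 A′) μ x` (`π(x ± e_ν) = (π x) ± e_ν`: FILE 25's `cover_add_e` ∕ `cover_sub_e`; the two
scalar conventions `(η : ℂ)⁻¹ •` and `η⁻¹ •` agree on `M_N(ℂ)`). [cite: Balaban1985RegularSpaces, (1.1)–(1.2) p.76; Balaban1987RG1, (0.1) p.251 (the torus)] -/
theorem codiffCurlA_cover_eq_pdiv (η : ℝ) {S : ℕ} {a : Pt P.d} {A : PBond P 0 → MatA N} {A' : B7Prop1Explicit.Site P.d → Fin P.d → MatA N}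
    (hA : ∀ z, z ∈ cubeExt S a 0 → ∀ κ, A ⟨cover P z, κ⟩ = A' z κ) {x : B7Prop1Explicit.Site P.d} {μ : Fin P.d}
    (hx : x ∈ cubeExt S a 0) (hxμ : x + e μ ∈ cubeExt S a 0)
    (hν : ∀ ν, x + e ν ∈ cubeExt S a 0 ∧ x - e ν ∈ cubeExt S a 0 ∧ x - e ν + e μ ∈ cubeExt S a 0) :
    Sect2.codiffCurlA η A (cover P x) μ = pdiv η (1 : B7Prop1Explicit.Site P.d → Fin P.d → (MatA N)ˣ) (plaqCovDeriv η 1 A') μ x := by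
  rw [pdiv_plaqCovDeriv_one_eq_sum, Sect2.codiffCurlA]
  refine Finset.sum_congr rfl fun ν _ => ?_
  obtain ⟨h1, h2, h3⟩ := hν ν
  rw [← cover_sub_e, Sect2.curlA, Sect2.curlA, grad, grad, grad, grad, ← cover_add_e, ← cover_add_e, ← cover_add_e, ← cover_add_e,
    plaqCovDeriv_one_apply, plaqCovDeriv_one_apply]
  simp only [sub_add_cancel, hA _ hx, hA _ hxμ, hA _ h1, hA _ h2, hA _ h3, ← Complex.ofReal_inv, Complex.coe_smul]

end Identity

/-! ## §2  ★★★ The push-down: Prop. 6 at the member ⇒ the local gauge WITH the (10)-letter on one grid cube of the torus -/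

section PushDown

variable {P : Params}

omit [NeZero N] in
/-- **UNIT STEPS BACKWARDS INSIDE THE PROJECTED CUBE LIFT TO UNIT STEPS BACKWARDS INSIDE THE BOX** (side `<` period): if `x ∈ cubeExt S a 0` and `(π x) − e_ν ∈
π(cubeExt S a 0)` then `x − e_ν ∈ cubeExt S a 0` (FILE 28b's forward version applied at the lift of `(π x) − e_ν`, plus injectivity of the cover on the box).
[cite: Balaban1987RG1, (0.1) p.251 (bookkeeping on the torus)] -/
theorem sub_e_mem_cubeExt_of_unshift_mem_image {S : ℕ} (hS : (S : ℤ) < P.sitesPerDir 0) {a x : Pt P.d} (hx : x ∈ cubeExt S a 0) {ν : Fin P.d}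
    (h : (cover P x).unshift ν ∈ cover P '' cubeExt S a 0) : x - e ν ∈ cubeExt S a 0 := by
  obtain ⟨z, hz, hcz⟩ := h
  have hzx : (cover P z).shift ν ∈ cover P '' cubeExt S a 0 := by
    rw [hcz, ← cover_sub_e, ← cover_add_e, sub_add_cancel]; exact ⟨x, hx, rfl⟩
  have hz' : z + e ν ∈ cubeExt S a 0 := add_e_mem_cubeExt_of_shift_mem_image hS hz hzx
  have hcov : cover P (z + e ν) = cover P x := by rw [cover_add_e, hcz, ← cover_sub_e, ← cover_add_e, sub_add_cancel]
  have := eq_of_cover_eq_of_mem_cubeExt hS.le hz' hx hcov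
  rw [← this, add_sub_cancel_right]; exact hz

/-- ★★★ **[6] PROPOSITION 6 AT NODE 00's `ℤᵈ` MEMBER ⇒ THE LOCAL GAUGE OF [15] (152) ON ONE GRID CUBE OF THE TORUS, `SU(N)`-VALUED, WITH THREE LETTERS** — FILE 28b's
★★★ `exists_localGauge_cube_of_prop6` (same hypotheses BYTE FOR BYTE: `d ≥ 2`; the Proposition-6 slot `B8.Prop6Printed d L B₁ c₁ (zdCub (M_N ℂ) L ·)`; the class
(1.7)∕(1.9)-Top of `U`; the scale `1 ≤ n ≤ kT + 1`; the non-wrapping grid cube `□ = cubeEnl P (LⁿM) a 0` with its Prop.-6 collar in the scale-`(n−1)` level set; print's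
«7dL²M′α₀ ≤ c₁» and the `2π`-window) with a FOURTH conjunct: on every DEEP bond `b` of `□` (33b's `Sect2.bondsDeep`: both endpoints and all their nearest neighbours
in `□`), `‖(∂^{η_n*}∂^{η_n}A)(b)‖ ≤ 2r` in 33b's letter `Sect2.codiffCurlA`, `r = 7dL²B₁M′·L³ε_{n−1}` — [15] (152)'s third member «(L^jη)³|∂^{η*}∂^ηA| < 9dL²B₁Mε₀» in the
record's letters.  The same `u`, `A` as in FILE 28b's construction (push-down of 34a's `s`, `Ã` through the cover, injective on the non-wrapping cube).
[cite: Balaban1985Variational, (144)–(152) pp.300–301, Thm 1 (10) p.279; Balaban1985RegularSpaces, Prop. 6 (1.135)–(1.136) p.99, p.98] -/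
theorem exists_localGauge10_cube_of_prop6 (hd : 2 ≤ P.d) {B₁ c₁ : ℝ} (hB₁ : 0 ≤ B₁)
    (hP6 : letI : CStarAlgebra (MatA N) := {}; B8.Prop6Printed P.d (P.L : ℝ) B₁ c₁ (fun i : ZdIdx P.d P.L => zdCub (MatA N) P.L i))
    {Ω : ℕ → Set (Site P 0)} {Ω₀ : Set (Site P 0)} {kT : ℕ} {ε : ℕ → ℝ} (U : GaugeField P 0 (SU N))
    (hP : ∀ m, m ≤ kT → PlaqSmallOn (Sect2.omegaPlaqsTop Ω Ω₀ m) (ε m * P.eta m ^ 2) U)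
    (hD : ∀ m, m ≤ kT → Sect2.CoDivSmallOn (Sect2.omegaBondsTop Ω Ω₀ m) (ε m * P.eta m ^ 3) U)
    {n : ℕ} (hn : 1 ≤ n) (hnk : n ≤ kT + 1) (hε : 0 < ε (n - 1)) {M : ℕ} (a : Pt P.d)
    (hSN : ((side P.L M n : ℕ) : ℤ) < P.sitesPerDir 0)
    (hcollar : cover P '' (cubeIdx' P n hn M a).Ω 0 ⊆ (if n - 1 = 0 then Ω₀ else Ω (n - 1)))
    (hc₁ : 7 * P.d * (P.L : ℝ) ^ 2 * (propCube P n hn M a).M * ((P.L : ℝ) ^ 3 * ε (n - 1)) ≤ c₁)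
    (h2π : (2 * boxWidth (bLo P.L (propCube P n hn M a).a (propCube P n hn M a).k 0)
        (bHi P.L (propCube P n hn M a).a (propCube P n hn M a).M (propCube P n hn M a).k 0) + 1) *
        (P.eta n * N * (7 * P.d * (P.L : ℝ) ^ 2 * B₁ * (propCube P n hn M a).M * ((P.L : ℝ) ^ 3 * ε (n - 1)) *
          ((P.L : ℝ) ^ (propCube P n hn M a).k * P.eta n)⁻¹)) < 2 * Real.pi) :
    ∃ u : GaugeTransf P 0 (SU N), ∃ A : PBond P 0 → MatA N,
      (∀ b ∈ (Sect2.regionOfSet P (cubeEnl P (side P.L M n) a 0)).bonds,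
          gaugeU (fun x => ιSU N (u x)) (fun b' => ιSU N (U b')) b = expI (P.eta n) (A b)) ∧
      (∀ b ∈ (Sect2.regionOfSet P (cubeEnl P (side P.L M n) a 0)).bonds,
          ‖A b‖ ≤ 2 * (7 * P.d * (P.L : ℝ) ^ 2 * B₁ * (propCube P n hn M a).M * ((P.L : ℝ) ^ 3 * ε (n - 1)))) ∧
      (∀ q ∈ (Sect2.regionOfSet P (cubeEnl P (side P.L M n) a 0)).dpairs,
          ‖grad (P.eta n) q.2.1 (fun y => A ⟨y, q.2.2⟩) q.1‖ ≤ 2 * (7 * P.d * (P.L : ℝ) ^ 2 * B₁ * (propCube P n hn M a).M * ((P.L : ℝ) ^ 3 * ε (n - 1)))) ∧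
      ∀ b ∈ Sect2.bondsDeep (cubeEnl P (side P.L M n) a 0),
          ‖Sect2.codiffCurlA (P.eta n) A b.src b.dir‖ ≤ 2 * (7 * P.d * (P.L : ℝ) ^ 2 * B₁ * (propCube P n hn M a).M * ((P.L : ℝ) ^ 3 * ε (n - 1))) := by
  classical
  letI : CStarAlgebra (MatA N) := {}
  have hL : 2 ≤ P.L := P.hL.2
  have hL1 : 1 ≤ P.L := P.L_pos
  have hηpos : 0 < P.eta n := B3GkZeroTorusRescaled.eta_pos P n
  set i : ZdIdx P.d P.L := cubeIdx' P n hn M a with hi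
  set c := propCube P n hn M a with hc
  set V := zdLift N U with hV
  set α : ℝ := (P.L : ℝ) ^ 3 * ε (n - 1) with hα
  have hαpos : 0 < α := by positivity
  have hInAk : InAk P.L i.k i.η α i.Ω V :=
    inAk_zdLift_of_top U hP hD hηpos (lvl := fun _ => n - 1) (fun j _ => by omega) (fun j _ => hcollar)
      (fun j hj => (tol_of_level_pred P hn hε.le hj).1) (fun j hj => (tol_of_level_pred P hn hε.le hj).2)
  have hVU : ∀ x κ, V x κ ∈ unitaryUnits (MatA N) := fun x κ => zdLift_mem_unitaryUnits U x κ
  have hG : GaugedBoundB8 P.L i.η V c (7 * P.d * (P.L : ℝ) ^ 2 * B₁ * c.M * α) :=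
    (prop6Printed_zdCub_iff (fun i : ZdIdx P.d P.L => i) B₁ c₁).1 hP6 i α hαpos ⟨V, hVU⟩ hInAk c hc₁
  set r : ℝ := 7 * P.d * (P.L : ℝ) ^ 2 * B₁ * c.M * α with hr
  have hr0 : 0 ≤ r := by positivity
  have hη' : i.η = P.eta n := rfl
  rw [hη'] at hG
  obtain ⟨s, A', h1, h2, h3, h4⟩ := exists_suGauge_letters10_of_gaugedBoundB8 hd hL c V (zdLift_mem_specialUnitaryUnits U) hηpos hr0 hG h2π
  have hscale : (P.L : ℝ) ^ c.k * P.eta n = 1 := B12Eq115BackgroundPair.pow_mul_eta P n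
  simp only [hscale, inv_one, mul_one, one_pow] at h2 h3 h4
  have hbox : cubeExt (side P.L M n) a 0 ⊆ box P.L c.a c.M c.k := cubeExt_subset_box_propCube P n hn M a
  -- push-down through the (injective) cover
  let u : GaugeTransf P 0 (SU N) := fun y =>
    if h : ∃ x, x ∈ cubeExt (side P.L M n) a 0 ∧ cover P x = y then s (Classical.choose h) else 1
  let A : PBond P 0 → MatA N := fun b =>
    if h : ∃ x, x ∈ cubeExt (side P.L M n) a 0 ∧ cover P x = b.src then A' (Classical.choose h) b.dir else 0
  have hu : ∀ x, x ∈ cubeExt (side P.L M n) a 0 → u (cover P x) = s x := by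
    intro x hx
    have hex : ∃ x', x' ∈ cubeExt (side P.L M n) a 0 ∧ cover P x' = cover P x := ⟨x, hx, rfl⟩
    simp only [u, dif_pos hex]
    rw [eq_of_cover_eq_of_mem_cubeExt hSN.le (Classical.choose_spec hex).1 hx (Classical.choose_spec hex).2]
  have hA : ∀ x, x ∈ cubeExt (side P.L M n) a 0 → ∀ μ, A ⟨cover P x, μ⟩ = A' x μ := by
    intro x hx μ
    have hex : ∃ x', x' ∈ cubeExt (side P.L M n) a 0 ∧ cover P x' = cover P x := ⟨x, hx, rfl⟩
    simp only [A, dif_pos hex]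
    rw [eq_of_cover_eq_of_mem_cubeExt hSN.le (Classical.choose_spec hex).1 hx (Classical.choose_spec hex).2]
  have hlift : ∀ y, y ∈ cubeEnl P (side P.L M n) a 0 → ∃ x, x ∈ cubeExt (side P.L M n) a 0 ∧ cover P x = y := by
    intro y hy
    obtain ⟨x, hx, rfl⟩ := hy
    simp only [Nat.zero_mul, Nat.cast_zero] at hx
    exact ⟨x, hx, rfl⟩
  have himage : ∀ y, y ∈ cubeEnl P (side P.L M n) a 0 → y ∈ cover P '' cubeExt (side P.L M n) a 0 := fun y hy => by
    obtain ⟨x, hx, rfl⟩ := hlift y hy; exact ⟨x, hx, rfl⟩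
  refine ⟨u, A, fun b hb => ?_, fun b hb => ?_, fun q hq => ?_, fun b hb => ?_⟩
  · obtain ⟨x, hx, hxs⟩ := hlift b.src hb.1
    have hx' : x + e b.dir ∈ cubeExt (side P.L M n) a 0 :=
      add_e_mem_cubeExt_of_shift_mem_image hSN hx (by rw [hxs]; exact himage _ hb.2)
    have hb' : b = ⟨cover P x, b.dir⟩ := by cases b; simp only at hxs; rw [hxs]
    rw [hb', hA x hx]
    have hgauge := h1 x b.dir (hbox hx) (hbox hx')
    rw [cfgExp_eq_expI] at hgauge
    rw [← hgauge]
    simp only [gaugeU, B7Prop1Explicit.gaugeAct, PBond.tgt, ← cover_add_e, hu x hx, hu (x + e b.dir) hx', hV, zdLift_apply]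
  · obtain ⟨x, hx, hxs⟩ := hlift b.src hb.1
    have hx' : x + e b.dir ∈ cubeExt (side P.L M n) a 0 :=
      add_e_mem_cubeExt_of_shift_mem_image hSN hx (by rw [hxs]; exact himage _ hb.2)
    have hb' : b = ⟨cover P x, b.dir⟩ := by cases b; simp only at hxs; rw [hxs]
    rw [hb', hA x hx]
    exact h2 x b.dir (hbox hx) (hbox hx')
  · obtain ⟨hq1, hq2, hq3, -⟩ := hq
    obtain ⟨x, hx, hxs⟩ := hlift q.1 hq1
    have hxμ : x + e q.2.1 ∈ cubeExt (side P.L M n) a 0 :=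
      add_e_mem_cubeExt_of_shift_mem_image hSN hx (by rw [hxs]; exact himage _ hq2)
    have hxν : x + e q.2.2 ∈ cubeExt (side P.L M n) a 0 :=
      add_e_mem_cubeExt_of_shift_mem_image hSN hx (by rw [hxs]; exact himage _ hq3)
    rw [grad, ← hxs, ← cover_add_e, hA x hx, hA (x + e q.2.1) hxμ, norm_smul, norm_inv, Complex.norm_real, Real.norm_eq_abs, abs_of_pos hηpos]
    calc (P.eta n)⁻¹ * ‖A' (x + e q.2.1) q.2.2 - A' x q.2.2‖ ≤ (P.eta n)⁻¹ * (2 * (P.eta n * r)) :=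
          mul_le_mul_of_nonneg_left (h3 x q.2.1 q.2.2 (hbox hx) (hbox hxμ) (hbox hxν)) (inv_nonneg.2 hηpos.le)
      _ = 2 * r := by field_simp
  · obtain ⟨hb1, hb2, hbν⟩ := hb
    obtain ⟨x, hx, hxs⟩ := hlift b.src hb1
    have hxμ : x + e b.dir ∈ cubeExt (side P.L M n) a 0 :=
      add_e_mem_cubeExt_of_shift_mem_image hSN hx (by rw [hxs]; exact himage _ hb2)
    have hstencil : ∀ ν, x + e ν ∈ cubeExt (side P.L M n) a 0 ∧ x - e ν ∈ cubeExt (side P.L M n) a 0 ∧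
        x - e ν + e b.dir ∈ cubeExt (side P.L M n) a 0 := by
      intro ν
      obtain ⟨s1, s2, s3, s4⟩ := hbν ν
      have hxν : x + e ν ∈ cubeExt (side P.L M n) a 0 :=
        add_e_mem_cubeExt_of_shift_mem_image hSN hx (by rw [hxs]; exact himage _ s1)
      have hxν' : x - e ν ∈ cubeExt (side P.L M n) a 0 :=
        sub_e_mem_cubeExt_of_unshift_mem_image hSN hx (by rw [hxs]; exact himage _ s2)
      have hxν'' : x - e ν + e b.dir ∈ cubeExt (side P.L M n) a 0 :=
        add_e_mem_cubeExt_of_shift_mem_image hSN hxν' (by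
          rw [cover_sub_e, hxs, ← Site.unshift_shift_comm]
          exact himage _ s4)
      exact ⟨hxν, hxν', hxν''⟩
    have hb' : b = ⟨cover P x, b.dir⟩ := by cases b; simp only at hxs; rw [hxs]
    rw [hb']
    show ‖Sect2.codiffCurlA (P.eta n) A (cover P x) b.dir‖ ≤ 2 * r
    rw [codiffCurlA_cover_eq_pdiv (P.eta n) hA hx hxμ hstencil]
    exact h4 x b.dir (hbox hx) (hbox hxμ) fun ν => ⟨hbox (hstencil ν).1, hbox (hstencil ν).2.1, hbox (hstencil ν).2.2⟩

end PushDown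

end Literature.MathematicalPhysics.QuantumFieldTheory.Balaban1983to89.Node00

end
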